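/-
Copyright: lit-balaban cell, Phase-2 proof seat p03.  Reproduction of published definitions; nothing is claimed beyond what
the kernel checks below.
-/
import Mathlib
import Literature.MathematicalPhysics.QuantumFieldTheory.Balaban1983to89.B6Lemma24PrintedShape
import Literature.MathematicalPhysics.QuantumFieldTheory.BalabanImbrieJaffe1984to88.BIJ85Sect1Model
import Literature.MathematicalPhysics.QuantumFieldTheory.BalabanImbrieJaffe1984to88.BIJ85AxialGauge34

/-!
# `BalabanImbrieJaffe1984to88.BIJ85AxialGauge35` — T. Bałaban, J. Imbrie, A. Jaffe, *Renormalization of the Higgs model: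
minimizers, propagators and the stability of mean field theory*, Commun. Math. Phys. **97** (1985) 299–329
[BalabanImbrieJaffe1985]: Sect. 3 p. 306 — the block-average constraint factors of the renormalization transformation
(3.3): δ(v/Qu) (3.5) over the nonlinear average (2.10), and the approximate delta function δ_H(ψ − Qφ) (3.6) over the
covariant average (2.6); companion of `BIJ85AxialGauge34` ((3.4), 𝒢₀, axial gauge fixing; same seat, same carrier).

statement-level skeleton of published theorems with citation tags; proofs where landed; nothing here is a claim about
the Yang–Mills mass gap

PDF held: `paper:balaban1985-cmp97-bij-higgs-minimizers` (journal page = PDF page + 298); p. 306 [PDF 8] and p. 303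
[PDF 5] read on the renders `HOME/lit-balaban-r15/pages/1985-cmp97-bij-higgs-minimizers-p008-x2.png`,
`pub-balaban/t4/b2b-balaban-t4-lit2/renders/bij1985/1985-cmp97-bij-higgs-minimizers-p005-x2.png`.
SKELETON row `C1.Eq3.4-3.6` (`HOME/lit-balaban-r15/ROWS-C1.md` r15-C1-28; owner r15, referee ref-5); Phase-2 seat p03,
unit `lit-balaban-p03`, HOME `run/shared/lean/pub/lit-balaban/`.

THE PRINTED TEXT (p. 306 [PDF 8], verbatim).  *"The factor δ(v/Qu) is a delta function which specifies that the average
gauge field in each block B(y) is v. Thus for b′ an L-lattice bond,  δ(v/Qu) = Π_{b′∈T_L} δ(v_{b′}/(Qu)_{b′}). (3.5)  The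
factor δ_H is an approximate delta function which specifies that the block averages of the scalar (Higgs) field equal ψ.
In particular, if y denotes an L-lattice site,  δ_H(ψ − Qφ) = Π_{y∈T_L} [(a/2π) exp(−(1/2)a|ψ − Q(u)φ|²)]. (3.6)  The
integral (3.2) therefore has the normalization property ∫𝒯e^{−S}𝒟v𝒟ψ = ∫e^{−S}𝒟u𝒟φ, (3.7)"*.  The averages entering,
p. 303 [PDF 5]: (2.6) *"(Qφ)_y = L^{−d} Σ_{x∈B(y)} u(Γ_{yx})φ_x"*; *"In the axial gauge, Qφ reduces to the ordinary average
of φ"*; (2.10) *"If b′ = yy′ is a bond on the L-lattice, then Γ_{yy′} = b′ and we average over contours Γ_{xx′} which are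
translates of Γ_{yy′}, i.e. x − x′ = y − y′. … (Qu)_{yy′} = u(Γ_{yy′}) exp[L^{−d} Σ_{x∈B(y)} ln u(Γ_{yx} ∘ Γ_{xx′} ∘
Γ_{y′x′}^{−1} ∘ Γ_{y′y})]. (2.10) In (2.10) choose the logarithm so that −π ≤ arg ln u < π. (2.11)"*.

CARRIER: as in `BIJ85AxialGauge34` (corner-anchored ℤ^d unit lattice of `…Balaban1983to89.B6BondElimination`, U(1) =
`Circle`, u(Γ_{yx}) = `BIJ85AxialGauge34.hol`); the branch (2.11) of ln = `BIJ85Sect1Model.argB` (decl of record of row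
C1.Eq2.10-2.11).  L-lattice bonds b′ = ⟨y, y + Le_μ⟩, y ∈ LZ^d, are indexed by the pairs `(y, μ)`.  The finite volume
(torus T_L) enters only (3.6), typed over a finite set `Y` of L-lattice sites (one period).

WHAT IS TYPED (defs with bodies) / PROVED.
* §0 supplement to (3.4) *"T(y) is maximal"*: b ↦ b₊ is a bijection T(y) → B(y) ∖ {y} (`tip_injOn`,
  `image_tip_treeBonds`), so |T(y)| = L^d − 1 (`card_treeBonds`) — with `BIJ85AxialGauge34.block_induction`, T(y) is a
  spanning tree of B(y).  PROVED.
* §1 (2.6) on this carrier `qCov` and p. 303 *"In the axial gauge, Qφ reduces to the ordinary average of φ"*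
  (`qCov_of_isAxial`) PROVED; (2.8) *"(Qφ)^h = Qφ^h"* in the form (Q_{u^h}φ^h)_y = h(y)(Q_uφ)_y (`qCov_gaugeAct`) PROVED
  from `BIJ85AxialGauge34.hol_gaugeAct` (the cell-level typing of record of (2.6)/(2.8) is `BIJ85CellAverages.Cells.Qcov` /
  `BIJ85ContourHolonomy.Qcov_hol_gauge`, transports as data; here the transports ARE the contour products).
* §2 (2.10) on this carrier `qU` (straight runs `run` = u(Γ_{yy′}), u(Γ_{xx′}); the closed contour `loop210`; the branch
  `argB`), its axial-gauge form `loop210_of_isAxial`; **(3.5)** `DeltaQ L v u` = the support of δ(v/Qu) (v_{b′} = (Qu)_{b′}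
  for every L-lattice bond b′), `deltaQ_qU`.
* §3 **(3.6)** `deltaH L a u φ ψ Y` = Π_{y∈Y} (a/2π) exp(−½a|ψ(y) − (Q(u)φ)(y)|²) (def with body, factors `gaussFactor`),
  `deltaH_pos`, and the fact that makes δ_H an *approximate delta function* of total mass one (the ingredient of (3.7)):
  `integral_gaussFactor` (∫_ℂ (a/2π)e^{−½a|ψ−c|²} dψ = 1 for a > 0; ℂ ≅ ℝ² with Lebesgue measure) PROVED from Mathlib's
  Gaussian integral.
* §4 GAUGE COVARIANCE OF THE CONSTRAINTS, PROVED: the straight-contour telescoping `run_gaugeAct`, the gauge invariance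
  of the closed contour of (2.10) `loop210_gaugeAct`, (Qu^h)_{⟨y,y′⟩} = h(y)(Qu)_{⟨y,y′⟩}h(y′)^{−1} (`qU_gaugeAct`, with
  `gaugeActL` = (2.7) on the L-lattice), the covariance of (3.5) `deltaQ_gaugeAct_iff`, the invariance of (3.6)
  `deltaH_gaugeAct`, and the typed content of *"They generate the gauge group of the integral 𝒯(exp −S)"*:
  `constraints_gaugeAct_iff_mem_G0` — a unit-lattice gauge transformation h preserves the joint support of
  δ_{Ax}(u)δ(v/Qu) (v transformed on the L-lattice) for all (u, v) iff h ∈ 𝒢₀.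
NOT DONE HERE.  (3.3) and (3.7) themselves (functional integrals); δ(v/Qu) is typed by its support, δ_H as the printed
density.  Row C1.Eq2.10-2.11 keeps its decls of record; `qU` is the contour formula (2.10) on this carrier, typed here
because (3.5) needs it.
-/

open Finset

namespace Literature.MathematicalPhysics.QuantumFieldTheory.BalabanImbrieJaffe1984to88.BIJ85AxialGauge35

open Literature.MathematicalPhysics.QuantumFieldTheory.Balaban1983to89
open B6Elimination B6BondElimination BIJ85AxialGauge34

noncomputable section

variable {d : ℕ} {L : ℕ}

/-! ## §0 Supplement to (3.4): T(y) is a maximal tree — it spans B(y) (`block_induction`) with |B(y)| − 1 bonds -/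

/-- Peeling along Γ_{yx}: every x ∈ B(y) other than the corner is the end-point b₊ of a tree bond b ∈ T(y) (the last
unit bond of Γ_{yx}). [cite: BalabanImbrieJaffe1985, (3.4) p.306] -/
theorem exists_treeBond_tip_eq {y x : Fin d → ℤ} (hx : x ∈ block L y) (hxy : x ≠ y) :
    ∃ b ∈ treeBonds L y, tip b = x := by
  have hS : (Finset.univ.filter fun i : Fin d => x i ≠ y i).Nonempty := by
    by_contra hc
    apply hxy
    funext i
    by_contra hne
    exact hc ⟨i, Finset.mem_filter.2 ⟨Finset.mem_univ i, hne⟩⟩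
  set μ := (Finset.univ.filter fun i : Fin d => x i ≠ y i).min' hS with hμdef
  have hμ : x μ ≠ y μ := (Finset.mem_filter.1 (Finset.min'_mem _ hS)).2
  have hmin : ∀ i, i < μ → x i = y i := by
    intro i hi
    by_contra hne
    have : μ ≤ i := Finset.min'_le _ i (Finset.mem_filter.2 ⟨Finset.mem_univ i, hne⟩)
    exact absurd hi (not_lt.2 this)
  have hxb := mem_block.1 hx
  have hxμ : y μ < x μ := lt_of_le_of_ne (hxb μ).1 (Ne.symm hμ)
  refine ⟨(x - unitVec μ, μ), ?_, ?_⟩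
  · have hz_apply : ∀ i, (x - unitVec μ) i = x i - if i = μ then 1 else 0 := fun i => by
      rw [Pi.sub_apply, unitVec_apply]
    rw [mem_treeBonds]
    refine ⟨mem_block.2 fun i => ?_, fun i hi => ?_, ?_⟩
    · show y i ≤ (x - unitVec μ) i ∧ (x - unitVec μ) i < y i + (L : ℤ)
      rw [hz_apply]
      obtain ⟨h1, h2⟩ := hxb i
      by_cases hi : i = μ
      · subst hi; rw [if_pos rfl]; omega
      · rw [if_neg hi]; omega
    · show (x - unitVec μ) i = y i
      rw [hz_apply, if_neg (ne_of_lt hi), sub_zero]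
      exact hmin i hi
    · show (x - unitVec μ) μ + 1 < y μ + L
      rw [hz_apply, if_pos rfl]
      have := (hxb μ).2
      omega
  · simp [tip]

/-- The end-point b₊ of a tree bond of B(y) lies in B(y) and is not the corner y. [cite: BalabanImbrieJaffe1985, (3.4) p.306] -/
theorem tip_mem_erase {y : Fin d → ℤ} {b : (Fin d → ℤ) × Fin d} (hb : b ∈ treeBonds L y) :
    tip b ∈ (block L y).erase y := by
  obtain ⟨hz, -, h2⟩ := mem_treeBonds.1 hb
  refine Finset.mem_erase.2 ⟨?_, add_unitVec_mem_block hz h2⟩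
  intro e
  have h3 := congr_fun e b.2
  rw [tip, add_unitVec_apply, if_pos rfl] at h3
  have h4 := (mem_block.1 hz b.2).1
  omega

/-- Distinct tree bonds of B(y) have distinct end-points b₊ (no site is entered twice: T(y) has no cycle).
[cite: BalabanImbrieJaffe1985, (3.4) p.306] -/
theorem tip_injOn (y : Fin d → ℤ) : Set.InjOn (tip (d := d)) (treeBonds L y : Set ((Fin d → ℤ) × Fin d)) := by
  rintro ⟨z, μ⟩ hb ⟨z', μ'⟩ hb' e
  simp only [Finset.mem_coe, mem_treeBonds] at hb hb'
  obtain ⟨hz, h1, -⟩ := hb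
  obtain ⟨hz', h1', -⟩ := hb'
  simp only [tip] at e
  have ec : ∀ i, z i + (if i = μ then 1 else 0) = z' i + (if i = μ' then 1 else 0) := fun i => by
    have := congr_fun e i
    rwa [add_unitVec_apply, add_unitVec_apply] at this
  rcases lt_trichotomy μ μ' with hlt | rfl | hgt
  · exfalso
    have e1 := ec μ
    rw [if_pos rfl, if_neg (ne_of_lt hlt), h1' μ hlt] at e1
    have := (mem_block.1 hz μ).1
    omega
  · simp only [Prod.mk.injEq, and_true]
    funext i
    have e1 := ec i
    by_cases hi : i = μ
    · subst hi; rw [if_pos rfl] at e1; omega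
    · rw [if_neg hi] at e1; omega
  · exfalso
    have e1 := ec μ'
    rw [if_pos rfl, if_neg (ne_of_lt hgt), h1 μ' hgt] at e1
    have := (mem_block.1 hz' μ').1
    omega

/-- b ↦ b₊ maps T(y) ONTO B(y) ∖ {y}. [cite: BalabanImbrieJaffe1985, (3.4) p.306] -/
theorem image_tip_treeBonds (y : Fin d → ℤ) : (treeBonds L y).image tip = (block L y).erase y := by
  ext x
  rw [Finset.mem_image]
  constructor
  · rintro ⟨b, hb, rfl⟩
    exact tip_mem_erase hb
  · intro hx
    obtain ⟨hxy, hxb⟩ := Finset.mem_erase.1 hx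
    obtain ⟨b, hb, e⟩ := exists_treeBond_tip_eq hxb hxy
    exact ⟨b, hb, e⟩

/-- *"T(y) is maximal"*: the tree has exactly |B(y)| − 1 = L^d − 1 bonds (b ↦ b₊ is a bijection T(y) → B(y) ∖ {y});
with `BIJ85AxialGauge34.block_induction` (T(y) reaches every site of B(y)) this is the statement that T(y) is a spanning
tree of the block, so that adjoining any further unit bond of B(y) closes a loop. [cite: BalabanImbrieJaffe1985, (3.4) p.306] -/
theorem card_treeBonds (hL : 0 < L) (y : Fin d → ℤ) : (treeBonds L y).card = L ^ d - 1 := by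
  have hy : y ∈ block L y := mem_block.2 fun i => ⟨le_rfl, by omega⟩
  rw [← Finset.card_image_of_injOn (tip_injOn y), image_tip_treeBonds, Finset.card_erase_of_mem hy, card_block]

/-! ## §1 (2.6) on this carrier; the p. 303 sentence on the axial gauge; (2.8) -/

/-- **(2.6)** *"(Qφ)_y = L^{−d} Σ_{x∈B(y)} u(Γ_{yx})φ_x"* on this carrier (the cell-level typing of record is
`BIJ85CellAverages.Cells.Qcov`, transports as data; here the transports ARE the contour products `hol`).
[cite: BalabanImbrieJaffe1985, (2.6) p.303] -/
def qCov (L : ℕ) (u : U1Cfg d) (φ : HiggsCfg d) (y : Fin d → ℤ) : ℂ :=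
  ((L : ℂ) ^ d)⁻¹ * ∑ x ∈ block L y, (hol L u y x : ℂ) * φ x

/-- p. 303: *"In the axial gauge, Qφ reduces to the ordinary average of φ"* — PROVED (u(Γ_{yx}) = 1 in axial gauge).
[cite: BalabanImbrieJaffe1985, (2.6) p.303] -/
theorem qCov_of_isAxial (hL : 0 < L) {u : U1Cfg d} (hu : IsAxial L u) (φ : HiggsCfg d) {y : Fin d → ℤ}
    (hy : ∀ i, (L : ℤ) ∣ y i) : qCov L u φ y = ((L : ℂ) ^ d)⁻¹ * ∑ x ∈ block L y, φ x := by
  unfold qCov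
  congr 1
  refine Finset.sum_congr rfl fun x hx => ?_
  rw [(isAxial_iff_hol hL u).1 hu y hy x hx, Circle.coe_one, one_mul]

/-- **(2.8)** *"Q commutes with gauge transformations … (Qφ)^h = Qφ^h"* on this carrier: (Q_{u^h}φ^h)_y = h(y)(Q_uφ)_y,
PROVED from the telescoping `hol_gaugeAct`. [cite: BalabanImbrieJaffe1985, (2.8) p.303] -/
theorem qCov_gaugeAct (h : GaugeFn d) (u : U1Cfg d) (φ : HiggsCfg d) (y : Fin d → ℤ) :
    qCov L (gaugeAct h u) (gaugeHiggs h φ) y = (h y : ℂ) * qCov L u φ y := by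
  unfold qCov gaugeHiggs
  rw [Finset.mul_sum, Finset.mul_sum, Finset.mul_sum]
  refine Finset.sum_congr rfl fun x hx => ?_
  rw [hol_gaugeAct h u y x hx]
  push_cast
  have hx0 : (h x : ℂ) ≠ 0 := Circle.coe_ne_zero _
  field_simp

/-! ## §2 (2.10) on this carrier and (3.5) -/

/-- The straight contour of n unit bonds from x in the direction e_μ: u([x, x + n e_μ]) = Π_{t<n} u_{⟨x+te_μ, x+(t+1)e_μ⟩}
(for n = L and x = y a corner this is u(Γ_{yy′}) = u(b′), b′ = ⟨y, y + Le_μ⟩ the L-lattice bond read as a path of unit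
bonds; for x ∈ B(y) it is u(Γ_{xx′}), the translate of Γ_{yy′}). [cite: BalabanImbrieJaffe1985, (2.10) p.303] -/
def run (u : U1Cfg d) (x : Fin d → ℤ) (μ : Fin d) (n : ℕ) : Circle :=
  ∏ t ∈ Finset.range n, u (x + (t : ℤ) • unitVec μ, μ)

/-- The closed contour of (2.10): u(Γ_{yx} ∘ Γ_{xx′} ∘ Γ_{y′x′}^{−1} ∘ Γ_{y′y}) with y′ = y + Le_μ, x′ = x + Le_μ
(abelian group: the product of the four transports, the last two inverted). [cite: BalabanImbrieJaffe1985, (2.10) p.303] -/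
def loop210 (L : ℕ) (u : U1Cfg d) (y : Fin d → ℤ) (μ : Fin d) (x : Fin d → ℤ) : Circle :=
  hol L u y x * run u x μ L * (hol L u (y + (L : ℤ) • unitVec μ) (x + (L : ℤ) • unitVec μ))⁻¹ * (run u y μ L)⁻¹

/-- **(2.10)** *"(Qu)_{yy′} = u(Γ_{yy′}) exp[L^{−d} Σ_{x∈B(y)} ln u(Γ_{yx} ∘ Γ_{xx′} ∘ Γ_{y′x′}^{−1} ∘ Γ_{y′y})]"* for the
L-lattice bond b′ = ⟨y, y + Le_μ⟩ (indexed by `c = (y, μ)`), with *"ln"* in the branch (2.11) (`BIJ85Sect1Model.argB`, ln u = i·argB u):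
exp[i L^{−d} Σ argB(…)] ∈ U(1). [cite: BalabanImbrieJaffe1985, (2.10) p.303] -/
def qU (L : ℕ) (u : U1Cfg d) (c : (Fin d → ℤ) × Fin d) : Circle :=
  run u c.1 c.2 L * Circle.exp (((L : ℝ) ^ d)⁻¹ * ∑ x ∈ block L c.1, BIJ85Sect1Model.argB (loop210 L u c.1 c.2 x : ℂ))

/-- In the axial gauge the block transports drop out of (2.10): the closed contour reduces to
u(Γ_{xx′})u(Γ_{yy′})^{−1} (y ∈ LZ^d, x ∈ B(y)). [cite: BalabanImbrieJaffe1985, (2.10) p.303] -/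
theorem loop210_of_isAxial (hL : 0 < L) {u : U1Cfg d} (hu : IsAxial L u) {y : Fin d → ℤ} (hy : ∀ i, (L : ℤ) ∣ y i)
    (μ : Fin d) {x : Fin d → ℤ} (hx : x ∈ block L y) :
    loop210 L u y μ x = run u x μ L * (run u y μ L)⁻¹ := by
  have hy' : ∀ i, (L : ℤ) ∣ (y + (L : ℤ) • unitVec μ) i := fun i => by
    rw [add_smul_unitVec_apply]
    split_ifs
    · exact dvd_add (hy i) (dvd_refl _)
    · simpa using hy i
  unfold loop210
  rw [(isAxial_iff_hol hL u).1 hu y hy x hx, (isAxial_iff_hol hL u).1 hu _ hy' _ (B6Lemma24PrintedShape.add_smul_mem_block hx μ), one_mul,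
    inv_one, mul_one]

/-- **(3.5)** *"δ(v/Qu) = Π_{b′∈T_L} δ(v_{b′}/(Qu)_{b′})"*, typed by its support: the L-lattice gauge field v
(on the L-lattice bonds b′ = ⟨y, y + Le_μ⟩, y ∈ LZ^d, indexed by (y, μ)) equals the block average (2.10) of u on every
L-lattice bond. [cite: BalabanImbrieJaffe1985, (3.5) p.306] -/
def DeltaQ (L : ℕ) (v : (Fin d → ℤ) × Fin d → Circle) (u : U1Cfg d) : Prop :=
  ∀ c : (Fin d → ℤ) × Fin d, (∀ i, (L : ℤ) ∣ c.1 i) → v c = qU L u c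

/-- kernel: δ(v/Qu) is supported exactly at v = Qu on the L-lattice bonds. [cite: BalabanImbrieJaffe1985, (3.5) p.306] -/
theorem deltaQ_qU (u : U1Cfg d) : DeltaQ L (qU L u) u := fun _ _ => rfl

/-! ## §3 (3.6): the approximate delta function δ_H -/

/-- One factor of (3.6): the normalised Gaussian (a/2π) exp(−½a|ψ − c|²) on ℂ. [cite: BalabanImbrieJaffe1985, (3.6) p.306] -/
def gaussFactor (a : ℝ) (c ψ : ℂ) : ℝ := a / (2 * Real.pi) * Real.exp (-(1 / 2) * a * ‖ψ - c‖ ^ 2)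

/-- **(3.6)** *"δ_H(ψ − Qφ) = Π_{y∈T_L} [(a/2π) exp(−(1/2)a|ψ − Q(u)φ|²)]"* with Q(u)φ the covariant average (2.6)
(`qCov`), the product running over the finite set `Y` of L-lattice sites (the sites of the torus T_L).
[cite: BalabanImbrieJaffe1985, (3.6) p.306] -/
def deltaH (L : ℕ) (a : ℝ) (u : U1Cfg d) (φ : HiggsCfg d) (ψ : (Fin d → ℤ) → ℂ) (Y : Finset (Fin d → ℤ)) : ℝ :=
  ∏ y ∈ Y, gaussFactor a (qCov L u φ y) (ψ y)

/-- δ_H > 0 for a > 0 (an *approximate* delta function: a strictly positive density). [cite: BalabanImbrieJaffe1985, (3.6) p.306] -/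
theorem deltaH_pos {a : ℝ} (ha : 0 < a) (u : U1Cfg d) (φ : HiggsCfg d) (ψ : (Fin d → ℤ) → ℂ)
    (Y : Finset (Fin d → ℤ)) : 0 < deltaH L a u φ ψ Y :=
  Finset.prod_pos fun _ _ => mul_pos (div_pos ha (by positivity)) (Real.exp_pos _)

/-- Why (3.6) is an approximate δ-FUNCTION (total mass one in each ψ(y), the ingredient of the normalization (3.7)):
∫_ℂ (a/2π) exp(−½a|ψ − c|²) dψ = 1 for a > 0 (ℂ ≅ ℝ², Lebesgue measure). PROVED from Mathlib's Gaussian integral.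
[cite: BalabanImbrieJaffe1985, (3.6) p.306] -/
theorem integral_gaussFactor {a : ℝ} (ha : 0 < a) (c : ℂ) : ∫ ψ : ℂ, gaussFactor a c ψ = 1 := by
  unfold gaussFactor
  rw [MeasureTheory.integral_const_mul]
  have h1 : ∫ ψ : ℂ, Real.exp (-(1 / 2) * a * ‖ψ - c‖ ^ 2) = ∫ ψ : ℂ, Real.exp (-(a / 2) * ‖ψ‖ ^ 2) := by
    rw [← MeasureTheory.integral_sub_right_eq_self (fun ψ : ℂ => Real.exp (-(a / 2) * ‖ψ‖ ^ 2)) c]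
    congr 1
    funext ψ
    ring_nf
  have h2 : ∫ ψ : ℂ, Real.exp (-(a / 2) * ‖ψ‖ ^ 2) = Real.pi / (a / 2) := by
    have h := GaussianFourier.integral_rexp_neg_mul_sq_norm (V := ℂ) (half_pos ha)
    rw [Complex.finrank_real_complex] at h
    rw [h]
    norm_num
  rw [h1, h2]
  have hπ : Real.pi ≠ 0 := Real.pi_ne_zero
  field_simp

/-! ## §4 Gauge covariance of the constraint factors: Qu and Q(u)φ transform under h restricted to the L-lattice -/

/-- (2.7) transported to the L-lattice: an L-lattice gauge field v_{b′}, b′ = ⟨y, y + Le_μ⟩, transforms under the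
restriction of h to the corners as v_{b′} → h(y)h(y + Le_μ)^{−1}v_{b′}. [cite: BalabanImbrieJaffe1985, (2.7) p.303] -/
def gaugeActL (L : ℕ) (h : GaugeFn d) (v : (Fin d → ℤ) × Fin d → Circle) : (Fin d → ℤ) × Fin d → Circle :=
  fun c => h c.1 * (h (c.1 + (L : ℤ) • unitVec c.2))⁻¹ * v c

/-- Composition (2.5) along a straight contour: u([x, x + (n+1)e_μ]) = u([x, x + ne_μ]) u_{⟨x+ne_μ, x+(n+1)e_μ⟩}.
[cite: BalabanImbrieJaffe1985, (2.5) p.302] -/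
theorem run_succ (u : U1Cfg d) (x : Fin d → ℤ) (μ : Fin d) (n : ℕ) :
    run u x μ (n + 1) = run u x μ n * u (x + (n : ℤ) • unitVec μ, μ) := by
  unfold run
  rw [Finset.prod_range_succ]

/-- Telescoping along the straight contours: u^h([x, x + ne_μ]) = h(x)u([x, x + ne_μ])h(x + ne_μ)^{−1}.
[cite: BalabanImbrieJaffe1985, (2.10) p.303] -/
theorem run_gaugeAct (h : GaugeFn d) (u : U1Cfg d) (x : Fin d → ℤ) (μ : Fin d) (n : ℕ) :
    run (gaugeAct h u) x μ n = h x * run u x μ n * (h (x + (n : ℤ) • unitVec μ))⁻¹ := by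
  induction n with
  | zero => simp [run]
  | succ n ih =>
    rw [run_succ, run_succ, ih, gaugeAct_apply]
    have e : tip (x + (n : ℤ) • unitVec μ, μ) = x + ((n + 1 : ℕ) : ℤ) • unitVec μ := by
      simp only [tip]
      push_cast
      rw [add_smul, one_smul, add_assoc]
    rw [e]
    apply Circle.ext
    push_cast
    field_simp

/-- The closed contour of (2.10) is gauge INVARIANT (a closed loop: all factors h cancel), x ∈ B(y).
[cite: BalabanImbrieJaffe1985, (2.10) p.303] -/
theorem loop210_gaugeAct (h : GaugeFn d) (u : U1Cfg d) {y : Fin d → ℤ} (μ : Fin d) {x : Fin d → ℤ}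
    (hx : x ∈ block L y) : loop210 L (gaugeAct h u) y μ x = loop210 L u y μ x := by
  unfold loop210
  rw [hol_gaugeAct h u y x hx, hol_gaugeAct h u _ _ (B6Lemma24PrintedShape.add_smul_mem_block hx μ), run_gaugeAct, run_gaugeAct]
  apply Circle.ext
  push_cast
  field_simp

/-- GAUGE COVARIANCE OF (2.10): (Qu^h)_{b′} = h(y)(Qu)_{b′}h(y′)^{−1} for b′ = ⟨y, y′⟩ — Q intertwines the unit-lattice
gauge transformation h with its restriction to the L-lattice (the analogue for u of (2.8)). [cite: BalabanImbrieJaffe1985, (2.10) p.303] -/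
theorem qU_gaugeAct (h : GaugeFn d) (u : U1Cfg d) (c : (Fin d → ℤ) × Fin d) :
    qU L (gaugeAct h u) c = gaugeActL L h (qU L u) c := by
  unfold qU gaugeActL
  rw [run_gaugeAct]
  have e : ∑ x ∈ block L c.1, BIJ85Sect1Model.argB (loop210 L (gaugeAct h u) c.1 c.2 x : ℂ) =
      ∑ x ∈ block L c.1, BIJ85Sect1Model.argB (loop210 L u c.1 c.2 x : ℂ) :=
    Finset.sum_congr rfl fun x hx => by rw [loop210_gaugeAct h u c.2 hx]
  rw [e]
  apply Circle.ext
  push_cast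
  ring

/-- Hence the constraint (3.5) is gauge COVARIANT: v = Qu iff v^h = Q(u^h) on the L-lattice, for every h.
[cite: BalabanImbrieJaffe1985, (3.5) p.306] -/
theorem deltaQ_gaugeAct_iff (h : GaugeFn d) (v : (Fin d → ℤ) × Fin d → Circle) (u : U1Cfg d) :
    DeltaQ L (gaugeActL L h v) (gaugeAct h u) ↔ DeltaQ L v u := by
  unfold DeltaQ
  refine forall_congr' fun c => forall_congr' fun _ => ?_
  rw [qU_gaugeAct, gaugeActL, gaugeActL]
  constructor
  · intro e
    exact mul_left_cancel e
  · intro e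
    rw [e]

/-- … and the factor (3.6) is gauge INVARIANT: δ_H(ψ^h − Q(u^h)φ^h) = δ_H(ψ − Q(u)φ) with ψ^h(y) = h(y)ψ(y), for every
h (|h(y)| = 1 and (2.8)). [cite: BalabanImbrieJaffe1985, (3.6) p.306] -/
theorem deltaH_gaugeAct (a : ℝ) (h : GaugeFn d) (u : U1Cfg d) (φ : HiggsCfg d) (ψ : (Fin d → ℤ) → ℂ)
    (Y : Finset (Fin d → ℤ)) :
    deltaH L a (gaugeAct h u) (gaugeHiggs h φ) (gaugeHiggs h ψ) Y = deltaH L a u φ ψ Y := by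
  unfold deltaH gaussFactor
  refine Finset.prod_congr rfl fun y _ => ?_
  rw [qCov_gaugeAct, gaugeHiggs, ← mul_sub, norm_mul, Circle.norm_coe, one_mul]

/-- THE GAUGE GROUP OF THE CONSTRAINTS (the typed content of *"They generate the gauge group of the integral
𝒯(exp −S)"* for the three δ-factors of (3.3)): a unit-lattice gauge transformation h carries the joint support of
δ_{Ax}(u)δ(v/Qu) (with v transformed on the L-lattice) into itself for all (u, v) iff h ∈ 𝒢₀; δ_H is invariant under every
h (`deltaH_gaugeAct`). [cite: BalabanImbrieJaffe1985, (3.5) p.306] -/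
theorem constraints_gaugeAct_iff_mem_G0 (hL : 0 < L) (h : GaugeFn d) :
    (∀ (u : U1Cfg d) (v : (Fin d → ℤ) × Fin d → Circle), IsAxial L u → DeltaQ L v u →
        IsAxial L (gaugeAct h u) ∧ DeltaQ L (gaugeActL L h v) (gaugeAct h u)) ↔ h ∈ G0 L d := by
  constructor
  · intro H
    exact mem_G0_of_isAxial_gaugeAct hL isAxial_one (H 1 (qU L 1) isAxial_one (deltaQ_qU 1)).1
  · intro hh u v hu hv
    exact ⟨hu.gaugeAct_of_mem_G0 hL hh, (deltaQ_gaugeAct_iff h v u).2 hv⟩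

end

end Literature.MathematicalPhysics.QuantumFieldTheory.BalabanImbrieJaffe1984to88.BIJ85AxialGauge35
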